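import Mathlib
import Summits.Ventures.PercRepro2.TypedSplit
import Summits.Ventures.PercRepro2.OneTypedEdge
import Summits.Ventures.PercRepro2.BasePendant
import Summits.Ventures.PercRepro2.TypedPendant
import Summits.Ventures.PercRepro2.TypedSeries

/-!
# The pendant `o·b` pair: a class-`1` leaf edge carrying BOTH `o` and `b` reduces `K₃` to its
same-slot part (blind cell PercRepro2, mine-2 g52, 2026-08-29; `conjectures/MINE-2.md` M2-109)

Night-3's leaf rules (`TypedPendant.lean`) use that every term of `K₃` carries `o` in exactly one
copy and `b` in exactly one copy.  When the two marks sit on ONE leaf `w` (`o = b = w`, the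
contracted form of a pendant `o` at a pendant `b`) the kernel is NOT linear in the pair: closing
the leaf edge isolates both marks (`st_update_pendant_pair`: the state is `killOB` of the state
with the edge open), and on states `KB = KP + KQ + KR` (`KB_eq_KP_add`) with `KP` the three terms
carrying `o` and `b` in the third copy, `KQ` the four terms carrying them in the second and third
copies, `KR` the one term carrying them in the first and second; isolating the pair in a copy
kills every term with a pair-factor there (`KB_killOB`).  Hence **`typedCount_pendant_pair_one`**:
at a class-`1` leaf edge carrying the pair only the same-slot part survives — the typed count of
`K₃` is the typed count, with the edge pinned open, of `KP` — and on pair-states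
**`KP_pair`**: `KP x y z = 2 · pd(x) · q(y) · q(z) · [the pair and `a₃` on opposite sides in z]`.
The generic engine is **`typedCount_peel`**: for ANY state kernel and ANY leaf whose closing acts
on the state by a kill, the typed count splits into the `Bool³` placements of the leaf edge with
the edge pinned OPEN and the kill applied in the closed copies (night-3's split + the repinning of
`TypedSeries.lean`).  Own work; standard axioms.
-/

namespace Summit.Ventures.PercRepro2

namespace CovForm

namespace TypedRed

open OneTyped

/-! ## The pair-kill on states and the three parts of the kernel -/

section States

/-- The state with the pair `o = b` isolated (`L_o = H_o = L_b = H_b = false`). -/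
def killOB (s : St) : St := (s.1, false, false, false, false, s.2.2.2.2.2.1, s.2.2.2.2.2.2)

/-- `killOB` keeps `q'`. -/
@[simp] lemma killOB_q' (s : St) : (killOB s).q' = s.q' := rfl
/-- `killOB` isolates `o` from `C(a₁)`. -/
@[simp] lemma killOB_Lo (s : St) : (killOB s).Lo = false := rfl
/-- `killOB` isolates `o` from `C(a₂)`. -/
@[simp] lemma killOB_Ho (s : St) : (killOB s).Ho = false := rfl
/-- `killOB` isolates `b` from `C(a₁)`. -/
@[simp] lemma killOB_Lb (s : St) : (killOB s).Lb = false := rfl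
/-- `killOB` isolates `b` from `C(a₂)`. -/
@[simp] lemma killOB_Hb (s : St) : (killOB s).Hb = false := rfl
/-- `killOB` keeps `L3`. -/
@[simp] lemma killOB_L3 (s : St) : (killOB s).L3 = s.L3 := rfl
/-- `killOB` keeps `H3`. -/
@[simp] lemma killOB_H3 (s : St) : (killOB s).H3 = s.H3 := rfl
/-- `pdB` sees only `q', L3, H3`. -/
lemma pdB_killOB (s : St) : pdB (killOB s) = pdB s := rfl
/-- `qB` sees only `q'`. -/
lemma qB_killOB (s : St) : qB (killOB s) = qB s := rfl

/-- **The same-slot part of `K₃`**: the three terms carrying both `o` and `b` in the third copy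
(`T₁ + T₃ + T₇`). -/
def KP (x y z : St) : ℤ :=
  pdB x * (qB y * (qB z * (sigB z.Lo z.Ho * sigB z.Lb z.Hb)))
  - pdB x * (qB y * (qB z * (sigB z.L3 z.H3 * (uB z.Lo z.Ho * sigB z.Lb z.Hb))))
  - pdB x * (qB y * (pdB z * (uB z.Lo z.Ho * uB z.Lb z.Hb)))

/-- The four terms carrying `o` and `b` in the second and third copies (`T₂ + T₄ + T₆ + T₈`). -/
def KQ (x y z : St) : ℤ :=
  qB x * ((pdB y * uB y.Lo y.Ho) * (qB z * (sigB z.L3 z.H3 * sigB z.Lb z.Hb)))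
  - pdB x * ((qB y * sigB y.Lb y.Hb) * (qB z * sigB z.Lo z.Ho))
  + pdB x * ((qB y * sigB y.Lb y.Hb) * (qB z * (sigB z.L3 z.H3 * uB z.Lo z.Ho)))
  + qB x * ((pdB y * uB y.Lb y.Hb) * (pdB z * uB z.Lo z.Ho))

/-- The one term carrying `o` in the first and `b` in the second copy (`T₅`). -/
def KR (x y z : St) : ℤ :=
  - ((pdB x * uB x.Lo x.Ho) * ((qB y * sigB y.Lb y.Hb) * (qB z * sigB z.L3 z.H3)))

/-- `KB = KP + KQ + KR`. -/
lemma KB_eq_KP_add (x y z : St) : KB x y z = KP x y z + KQ x y z + KR x y z := by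
  unfold KB KP KQ KR; ring

/-- **The pendant-pair identity on states**: isolating the pair in a copy kills exactly the terms
with a pair-factor in that copy. -/
lemma KB_killOB (a b c : Bool) (x y z : St) :
    KB (cond a x (killOB x)) (cond b y (killOB y)) (cond c z (killOB z)) =
      (if c then KP x y z else 0) + (if b && c then KQ x y z else 0) +
        (if a && b then KR x y z else 0) := by
  cases a <;> cases b <;> cases c <;>
    simp only [cond_true, cond_false, KB, KP, KQ, KR, killOB_Lo, killOB_Ho, killOB_Lb,
      killOB_Hb, killOB_L3, killOB_H3, sigB_ff, uB_ff, pdB_killOB, qB_killOB, Bool.false_eq_true,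
      Bool.and_self, Bool.and_true, Bool.and_false, if_false, if_true] <;> ring

/-- **The same-slot part on pair-states**: when `o` and `b` share their status in the third copy
(`L_o = L_b`, `H_o = H_b`, and a mark cannot be in both clusters unless `Q` fails), `KP` is twice
`pd(x) · q(y) · q(z)` times the indicator that the pair and `a₃` lie on OPPOSITE sides in `z`. -/
lemma KP_pair (x y z : St) (h1 : z.Lo = z.Lb) (h2 : z.Ho = z.Hb)
    (h3 : z.Lo = true → z.Ho = true → z.q' = true) (h4 : z.L3 = true → z.H3 = true → z.q' = true) :
    KP x y z = 2 * (pdB x * (qB y * (qB z *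
      (if (z.Lo && z.H3) || (z.Ho && z.L3) then 1 else 0)))) := by
  obtain ⟨q, Lo, Ho, Lb, Hb, L3, H3⟩ := z
  simp only [St.Lo, St.Ho, St.Lb, St.Hb, St.L3, St.H3, St.q'] at h1 h2 h3 h4 ⊢
  subst h1 h2
  cases q <;> cases Lo <;> cases Ho <;> cases L3 <;> cases H3 <;>
    simp only [KP, pdB, qB, sigB, uB, St.q', St.Lo, St.Ho, St.Lb, St.Hb, St.L3, St.H3,
      Bool.or_self, Bool.or_true, Bool.or_false, Bool.and_self, Bool.and_true, Bool.and_false,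
      Bool.false_eq_true, if_false, if_true, forall_const, imp_false] at h3 h4 ⊢ <;> ring

end States

/-! ## The generic peeling of a leaf edge -/

section Peel

variable {E : Type*} [Fintype E] [DecidableEq E] {R : Type*} [CommRing R]

/-- **The generic peel**: for any state kernel `K` and any leaf edge `g` whose closing acts on the
state map `S` by the kill `kill` (`S (x[g := false]) = kill (S (x[g := true]))`), the typed count
is the `Bool³`-sum over the placements of `g` of the typed counts with `g` PINNED OPEN and the kill
applied in the closed copies. -/
theorem typedCount_peel (K : St → St → St → ℤ) (kill : St → St) (S : Config E → St) {g : E}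
    (hst : ∀ (x : Config E) (p : Bool), S (Function.update x g p) =
      cond p (S (Function.update x g true)) (kill (S (Function.update x g true))))
    (F : Finset E) (hgF : g ∈ F) (z : Config E) (τ : E → ℕ) :
    typedCount F z τ (fun x y w => ((K (S x) (S y) (S w) : ℤ) : R)) =
      ∑ p : Bool, ∑ q : Bool, ∑ r : Bool,
        if p.toNat + q.toNat + r.toNat = τ g then
          typedCount (F.erase g) (Function.update z g true) τ
            (fun x y w => ((K (cond p (S x) (kill (S x))) (cond q (S y) (kill (S y)))
              (cond r (S w) (kill (S w))) : ℤ) : R))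
        else 0 := by
  have hgF' : g ∉ F.erase g := fun h => (Finset.mem_erase.1 h).1 rfl
  rw [typedCount_split F g hgF]
  refine Finset.sum_congr rfl fun p _ => Finset.sum_congr rfl fun q _ =>
    Finset.sum_congr rfl fun r _ => ?_
  split_ifs
  · rw [typedCount_repin_false (F.erase g) g hgF' (Function.update z g true) τ,
      Function.update_idem, Function.update_self]
    refine typedCount_congr_K _ _ _ fun x y w => ?_
    rw [hst x p, hst y q, hst w r]
  · rfl

/-- The peel at a class-`1` leaf edge: the open copy in each slot, the kill in the other two. -/
theorem typedCount_peel_one (K : St → St → St → ℤ) (kill : St → St) (S : Config E → St) {g : E}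
    (hst : ∀ (x : Config E) (p : Bool), S (Function.update x g p) =
      cond p (S (Function.update x g true)) (kill (S (Function.update x g true))))
    (F : Finset E) (hgF : g ∈ F) (z : Config E) (τ : E → ℕ) (hτ : τ g = 1) :
    typedCount F z τ (fun x y w => ((K (S x) (S y) (S w) : ℤ) : R)) =
      typedCount (F.erase g) (Function.update z g true) τ
        (fun x y w => ((K (S x) (kill (S y)) (kill (S w)) + K (kill (S x)) (S y) (kill (S w)) +
          K (kill (S x)) (kill (S y)) (S w) : ℤ) : R)) := by
  rw [typedCount_peel K kill S hst F hgF z τ]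
  simp only [Fintype.sum_bool, Bool.toNat_true, Bool.toNat_false, hτ, cond_true, cond_false]
  norm_num
  rw [← typedCount_add, ← typedCount_add]
  refine typedCount_congr_K _ _ _ fun x y w => ?_
  ring

/-- The peel at a class-`2` leaf edge: the closed copy in each slot. -/
theorem typedCount_peel_two (K : St → St → St → ℤ) (kill : St → St) (S : Config E → St) {g : E}
    (hst : ∀ (x : Config E) (p : Bool), S (Function.update x g p) =
      cond p (S (Function.update x g true)) (kill (S (Function.update x g true))))
    (F : Finset E) (hgF : g ∈ F) (z : Config E) (τ : E → ℕ) (hτ : τ g = 2) :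
    typedCount F z τ (fun x y w => ((K (S x) (S y) (S w) : ℤ) : R)) =
      typedCount (F.erase g) (Function.update z g true) τ
        (fun x y w => ((K (kill (S x)) (S y) (S w) + K (S x) (kill (S y)) (S w) +
          K (S x) (S y) (kill (S w)) : ℤ) : R)) := by
  rw [typedCount_peel K kill S hst F hgF z τ]
  simp only [Fintype.sum_bool, Bool.toNat_true, Bool.toNat_false, hτ, cond_true, cond_false]
  norm_num
  rw [← typedCount_add, ← typedCount_add]
  refine typedCount_congr_K _ _ _ fun x y w => ?_
  ring

/-- The peel at a class-`3` (pinned-open) leaf edge: no kill. -/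
theorem typedCount_peel_three (K : St → St → St → ℤ) (kill : St → St) (S : Config E → St) {g : E}
    (hst : ∀ (x : Config E) (p : Bool), S (Function.update x g p) =
      cond p (S (Function.update x g true)) (kill (S (Function.update x g true))))
    (F : Finset E) (hgF : g ∈ F) (z : Config E) (τ : E → ℕ) (hτ : τ g = 3) :
    typedCount F z τ (fun x y w => ((K (S x) (S y) (S w) : ℤ) : R)) =
      typedCount (F.erase g) (Function.update z g true) τ
        (fun x y w => ((K (S x) (S y) (S w) : ℤ) : R)) := by
  rw [typedCount_peel K kill S hst F hgF z τ]
  simp only [Fintype.sum_bool, Bool.toNat_true, Bool.toNat_false, hτ, cond_true, cond_false]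
  norm_num

end Peel

/-! ## The pendant pair -/

section Pair

open Classical

variable {V : Type*} {E : Type*} [Fintype E] [DecidableEq E] {R : Type*} [Field R]
variable (ends : E → Sym2 V) (a₁ a₂ a₃ w : V)

omit [Fintype E] in
/-- At a pendant pair (a leaf `w` carrying exactly the marks `o = b = w`), closing the leaf edge
isolates both marks. -/
lemma st_update_pendant_pair {g : E} {v : V} (hg : ends g = s(w, v))
    (hleaf : ∀ e, w ∈ ends e → e = g) (hwv : w ≠ v) (hw1 : w ≠ a₁) (hw2 : w ≠ a₂)
    (hw3 : w ≠ a₃) (x : Config E) :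
    st ends w a₁ a₂ a₃ w (Function.update x g false) =
      killOB (st ends w a₁ a₂ a₃ w (Function.update x g true)) := by
  unfold st killOB
  simp only [Prod.mk.injEq]
  have hF : Function.update x g false g = false := Function.update_self g false x
  refine ⟨?_, ?_, ?_, ?_, ?_, ?_, ?_⟩
  · exact decide_eq_decide.mpr ((conn_update_leaf_iff hg hleaf hwv false hw2.symm hw1.symm).trans
      (conn_update_leaf_iff hg hleaf hwv true hw2.symm hw1.symm).symm)
  · exact decide_eq_false fun h => hw1 (conn_leaf_closed hg hleaf hwv hF (conn_symm h)).symm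
  · exact decide_eq_false fun h => hw2 (conn_leaf_closed hg hleaf hwv hF (conn_symm h)).symm
  · exact decide_eq_false fun h => hw1 (conn_leaf_closed hg hleaf hwv hF (conn_symm h)).symm
  · exact decide_eq_false fun h => hw2 (conn_leaf_closed hg hleaf hwv hF (conn_symm h)).symm
  · exact decide_eq_decide.mpr ((conn_update_leaf_iff hg hleaf hwv false hw1.symm hw3.symm).trans
      (conn_update_leaf_iff hg hleaf hwv true hw1.symm hw3.symm).symm)
  · exact decide_eq_decide.mpr ((conn_update_leaf_iff hg hleaf hwv false hw2.symm hw3.symm).trans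
      (conn_update_leaf_iff hg hleaf hwv true hw2.symm hw3.symm).symm)

omit [Fintype E] in
/-- The pair-kill hypothesis of `typedCount_peel` at a pendant pair. -/
lemma st_pendant_pair_cond {g : E} {v : V} (hg : ends g = s(w, v))
    (hleaf : ∀ e, w ∈ ends e → e = g) (hwv : w ≠ v) (hw1 : w ≠ a₁) (hw2 : w ≠ a₂)
    (hw3 : w ≠ a₃) (x : Config E) (p : Bool) :
    st ends w a₁ a₂ a₃ w (Function.update x g p) =
      cond p (st ends w a₁ a₂ a₃ w (Function.update x g true))
        (killOB (st ends w a₁ a₂ a₃ w (Function.update x g true))) := by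
  cases p
  · exact st_update_pendant_pair ends a₁ a₂ a₃ w hg hleaf hwv hw1 hw2 hw3 x
  · rfl

/-- **The pendant-pair rule (class `1`)**: at a typed edge `g = {w, v}` of class `1` whose end `w`
is a leaf carrying exactly the marks `o = b = w`, the typed count of `K₃` is the typed count, with
`g` pinned open (the pair sits at `v`), of the same-slot part `KP`. -/
theorem typedCount_pendant_pair_one {g : E} {v : V} (hg : ends g = s(w, v))
    (hleaf : ∀ e, w ∈ ends e → e = g) (hwv : w ≠ v) (hw1 : w ≠ a₁) (hw2 : w ≠ a₂)
    (hw3 : w ≠ a₃) (F : Finset E) (hgF : g ∈ F) (z : Config E) (τ : E → ℕ) (hτ : τ g = 1) :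
    typedCount F z τ (K3 ends w a₁ a₂ a₃ w : Config E → Config E → Config E → R) =
      typedCount (F.erase g) (Function.update z g true) τ
        (fun x y w' => ((KP (st ends w a₁ a₂ a₃ w x) (st ends w a₁ a₂ a₃ w y)
          (st ends w a₁ a₂ a₃ w w') : ℤ) : R)) := by
  have h1 : typedCount F z τ (K3 ends w a₁ a₂ a₃ w : Config E → Config E → Config E → R) =
      typedCount F z τ (fun x y w' => ((KB (st ends w a₁ a₂ a₃ w x) (st ends w a₁ a₂ a₃ w y)
        (st ends w a₁ a₂ a₃ w w') : ℤ) : R)) :=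
    typedCount_congr_K _ _ _ fun x y w' => K3_eq_KB ends w a₁ a₂ a₃ w x y w'
  rw [h1, typedCount_peel_one KB killOB (st ends w a₁ a₂ a₃ w)
    (st_pendant_pair_cond ends a₁ a₂ a₃ w hg hleaf hwv hw1 hw2 hw3) F hgF z τ hτ]
  refine typedCount_congr_K _ _ _ fun x y w' => ?_
  have e1 := KB_killOB true false false (st ends w a₁ a₂ a₃ w x) (st ends w a₁ a₂ a₃ w y)
    (st ends w a₁ a₂ a₃ w w')
  have e2 := KB_killOB false true false (st ends w a₁ a₂ a₃ w x) (st ends w a₁ a₂ a₃ w y)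
    (st ends w a₁ a₂ a₃ w w')
  have e3 := KB_killOB false false true (st ends w a₁ a₂ a₃ w x) (st ends w a₁ a₂ a₃ w y)
    (st ends w a₁ a₂ a₃ w w')
  simp only [cond_true, cond_false, Bool.and_self, Bool.and_true, Bool.and_false,
    Bool.false_eq_true, if_false, if_true, add_zero] at e1 e2 e3
  rw [e1, e2, e3]
  push_cast
  ring

end Pair

end TypedRed

end CovForm

end Summit.Ventures.PercRepro2
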